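import Literature.MathematicalPhysics.QuantumFieldTheory.Balaban1983to89.B8Thm4Zd3Gamma
import Literature.MathematicalPhysics.QuantumFieldTheory.Balaban1983to89.B8LeafModelZd3P
import Literature.MathematicalPhysics.QuantumFieldTheory.Balaban1983to89.B8TowerBondsPrinted
import Literature.MathematicalPhysics.QuantumFieldTheory.Balaban1983to89.B8Ineq166Univ

/-!
# `Balaban1983to89.B8LeafModelZd3PThm2Gamma` — [Balaban1985RegularSpaces] THEOREM 2 (p. 83) AS `B8.Thm2Printed` ON THE `Ω₀ = ℤᵈ` SUB-FAMILY OF THE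
# RE-TYPED CARRIER `B8LeafModelZd3P.zdGF3P` (print's classes), EDITION γ — the (D5) item of the §n05 γ chain: Theorem 2 ⇐ Theorem 4 (this seat's
# `B8Thm4Zd3Gamma.thm4Body_member_zd3P_γ`) + Proposition 3 on the carrier (a HYPOTHESIS here — `pub-ymgap-dag-n05-d`'s D3) + (1.65) (`B8Ineq166Univ`)

statement-level skeleton of published theorems with citation tags; proofs where landed; nothing here is a claim about the
Yang–Mills mass gap

PDF held: `paper:balaban1985-cmp99-regular-spaces-gauge-fixing` (journal page = PDF page + 74); Thm 2 p. 83, pp. 87–88 ((1.63)–(1.67): *«Of course this theorem implies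
Theorem 2. Proposition 3 implies that it is enough to prove (1.37), (1.38) and (1.67) …»*), (1.65)∕(1.66) p. 87, p. 77 (bond convention) — read first-hand this session.

CITATION HEADER (lean-in-tree rule).  Cell `pub-ymgap` (HUMAN RULING D-0062 ∕ D-0149, Track A), DAG node N05 = [B8], width seat `pub-ymgap-dag-n05-w2` (g0), key K1⁷
`stmt-QuantumFields-20542` (helper, count-neutral); plan W-SEAT-START-LIST v3∕v4 § n05: w2 = (D5).  WHY THIS FILE.  dag-n05-a's `B8LeafModelZd3Thm2.thm2Printed_zd3_univ`
assembles Theorem 2 on the `Ω₀ = ℤᵈ` sub-family of `zdGF3` from Theorem 4 + Proposition 3 + (1.65); the carrier of record moves to `zdGF3P` (`pub-ymgap-dag-n05-w1`: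
(1.35)∕(1.66) in print's one-end-point class `EndBlockIn`, (1.37)∕(1.42) over print's class `towerBondsP` — forced by dag-n05-d's `B8Prop3ShellModeVacuity` p585094).  THIS
FILE re-runs that assembly on the new carrier: Theorem 4 = this seat's `thm4Body_member_zd3P_γ` (p585688 v1.1; constant `B₁′ = 5dL·K·B₀`, `K = 26384(d+1)L`), applied at
print's shifted pair `(α₀, α″ = 11d²(α₀+α₁) + α₁)`; (1.66)₀ from (1.35) by `B8Ineq166Univ.norm_pert_sub_one_le_univ` (the box-form letter it eats follows from the
one-end-point letter); (1.37) at the ORIGINAL `α₁` ON PRINT's CLASS by this seat's `B8Eq142KLevelLocalGammaPrime.H42_of_inAx_γ'` (p587580) fed by the member's letter verbatim;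
(1.36)∕(1.39) by PROPOSITION 3 ON THE CARRIER, taken as the HYPOTHESIS `hP3 : B8.Prop3Printed d L C₂ inp B₀β (zdGF3P-family)` for any (1.61)-constant
`C₂ ≤ 2097152(d+1)²L²` (dag-n05-d's D3 supplies it; the γ schedule's constant is `16·131072(d+1)²·L²`), at `α₂ := 5dL·K·B₀·(α₀ + α″)`; uniqueness = Theorem 4's
((1.36) at `B₁(α₀+α₁) = 5dLB₀(α₀+α″) ≤ 5dL·K·B₀·(α₀+α″)`, (1.37) monotone in `α₁`).  Constants `B₁ = 5dLB₀(1 + 11d²)`, `B₂ = 5dL·B₀β·(1 + 11d²)` (print's, on `inp.B₀`), ONE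
threshold.  Kind «kernel-checked proof», one theorem, no `def`.

HONEST SCOPE ∕ A6.  Assembly by name; nothing of Propositions 3∕5, (1.42), (1.59), (1.65) is re-proved; Proposition 3 on the carrier and Theorem 4's four sockets (Prop. 5
∃ base ∕ ∃ step ∕ uniqueness; the β-shaped (1.59) socket over print's class — dag-n06-b's γ suppliers, A6-witnessed at truncation 0) are HYPOTHESES quantified over all members of
`ZdIdx` (a fortiori over the sub-family); the boundary-layer law is void at `Ω₀ = ℤᵈ`.  Count-neutral; N05 NOT discharged; one finite `𝕋⁴` programme at fixed `ε`, Bałaban AS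
PRINTED; the Yang–Mills mass gap (Clay) is NOT proved by any of this — R4 closes the conditional finite-`𝕋⁴` rung `BalabanLadder.UV` only; nothing continuum ∕ ℝ⁴ ∕ OS ∕
mass-gap.  No `sorry`, no `def`, no `instance`, no `notation`.  Unit `pub-ymgap-dag-n05-w2` (g0), 2026-08-28.

RELATED IN THE TREE, NOT DUPLICATED: `B8LeafModelZd3Thm2` (dag-n05-a; the `zdGF3` edition — proof pattern followed line by line), `B8Thm4Zd3Gamma` (this seat, USED),
`B8Eq142KLevelLocalGammaPrime` (this seat, USED), `B8Ineq166Univ` (lit-balaban ∕ dag-n05-a, USED), `B8LeafModelZd3P` (dag-n05-w1, the carrier), `B8Thm2AtConstants` (the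
abstract schedule — not used: its `h137` law is member-unconditional, here (1.37) needs the (1.42) lemma at the constructed gauge).
-/

noncomputable section

open NormedSpace

namespace Literature.MathematicalPhysics.QuantumFieldTheory.Balaban1983to89.B8LeafModelZd3PThm2Gamma

open Complex (I)
open MatrixLog B7Prop1Explicit B7Prop2Explicit B7Prop1Local B7Eq92Concrete
open B7Prop2Explicit (C0 c2')
open B7Prop3Flat (c3)
open B8Ineq132 (covDerivFwd InAk BondTouches)
open B8Eq119TwistedAxial (Restr129 InAx)
open B8Eq184Proof (gaugeExp cfgExp)
open B8Lemma1NonAbelian (mulCfg)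
open B8Eq140Level (SideTouches)
open B8Eq146AExpansion (iEta)
open B7Prop4GeneralLevels (linCovIter)
open B8Eq155JBound (Jcur wsup)
open B8ScaledSupNorm (bondNorm msup)
open B8Thm2LogB (blockTop)
open B8Ineq130 (tlo thi)
open B8Eq138LandauZd (IsLandau138W logCfg)
open B8Prop3GaugeFixedKLevel (mem_unitaryUnits_of_mgauge_eq mulCfg_eq_gaugeAct_of_mgauge_eq)
open B8Thm4AtLandau138 (mgauge_mgauge_inv)
open B8Thm4Windows (thm4_windows thm4_windows_extra)
open B8Thm4ExistsConcreteGamma (thm4_windows_γ)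
open B8LeafModelZd (SockP5base SockP5 SockP5u ZdIdx)
open B8LeafModelZd3 (mlogCfg mlogCfg_spec)
open B8LeafModelZd3P (zdGF3P zdGF3HP)
open B8TowerBondsPrinted (towerBondsP)
open B9SupplySockB9P3ZdBeta (CrossB)
open B8Ineq166Univ (norm_pert_sub_one_le_univ)

-- `Site` alone could resolve to the torus sites of `Setup.lean`; re-export the `ℤ^d` sites of `B7Prop1Explicit`.
export B7Prop1Explicit (Site)

variable {d : ℕ}

section Thm2

variable {𝔸 : Type} [CStarAlgebra 𝔸] [Nontrivial 𝔸]

/-- ★★ **`B8.Thm2Printed` ON THE `Ω₀ = ℤᵈ` SUB-FAMILY OF THE RE-TYPED CARRIER `zdGF3P`, EDITION γ** (Theorem 2, p. 83, via p. 88 «Of course this theorem implies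
Theorem 2»): for `d, L ≥ 2`, [4]'s inputs `inp` with `2 ≤ 5dL·inp.B₀`, `B₀β > 0`, Prop. 5's radius `cu > 0`, provider threshold `cP > 0`, collar constant `0 ≤ B_∂`,
`4B_∂ ≤ (dL − 1)·inp.B₀`, any Hölder data `β, len` — MODULO Theorem 4's member-wise sockets (`SockP5base`, `SockP5`, the β-shaped (1.59) socket over `towerBondsP`, `SockP5u`)
and PROPOSITION 3 on the carrier (`hP3`, any `C₂ ≤ 2097152(d+1)²L²`).  Constants `B₁ = 5dL·inp.B₀·(1 + 11d²)`, `B₂ = 5dL·B₀β·(1 + 11d²)`; see the module docstring.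
[cite: Balaban1985RegularSpaces, Thm 2 (1.36)–(1.39) p.83, Thm 4 p.88, Prop. 3 p.87, (1.65)–(1.67) pp.87–88, (1.35)∕(1.37) p.82, p.77] -/
theorem thm2Printed_zd3P_univ_γ (hd2 : 2 ≤ d) {L : ℕ} (hL : 2 ≤ L) {β : ℝ} {len : Site d → ℝ} (inp : B8.B9Inputs)
    {B₀β cu cP Bbd C₂ : ℝ} (hB₀β : 0 < B₀β) (hB : 2 ≤ 5 * (d : ℝ) * L * inp.B₀) (hcu : 0 < cu) (hcP : 0 < cP)
    (hBbd : 0 ≤ Bbd) (hBd : 4 * Bbd ≤ ((d : ℝ) * L - 1) * inp.B₀) (hC₂ : C₂ ≤ 2097152 * ((d : ℝ) + 1) ^ 2 * (L : ℝ) ^ 2)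
    -- Theorem 4's four sockets per member (this seat's `B8Thm4Zd3Gamma.thm4Body_member_zd3P_γ`), the (1.59) one over print's class `towerBondsP`
    (SP5base : ∀ i : ZdIdx d L, SockP5base (𝔸 := 𝔸) L inp.B₀ inp.B₀' cP i.η i.k i.Ω i.Λs)
    (SP5 : ∀ i : ZdIdx d L, SockP5 (𝔸 := 𝔸) L inp.B₀ inp.B₀' cP i.η i.k i.Ω i.Λs)
    (SH59Dβ : ∀ i : ZdIdx d L, ∀ α₀ α₁ : ℝ, 0 < α₀ → 0 < α₁ → α₀ + α₁ ≤ cP →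
        ∀ U₀ U' : Site d → Fin d → 𝔸ˣ, (∀ x κ, U₀ x κ ∈ unitaryUnits 𝔸) → (∀ x κ, U' x κ ∈ unitaryUnits 𝔸) →
        InAk L i.k i.η α₀ i.Ω U₀ → InAk L i.k i.η α₀ i.Ω (mulCfg U' U₀) → (∀ m, m ≤ i.k → InAx L m (i.Λs m) U₀ (mulCfg U' U₀)) →
        (∀ j, j ≤ i.k → ∀ (z : Site d) (μ : Fin d), (∀ x, InBox (loK L j z) (bondHiK L j z μ) x → x ∈ i.Ω j) →
          ‖(avgIter L (mulCfg U' U₀) j z μ : 𝔸) - (avgIter L U₀ j z μ : 𝔸)‖ ≤ α₁) →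
        (∀ b ∈ {b : Site d × Fin d | SideTouches (i.Ω 0) b.1 b.2}, ‖((U' b.1 b.2 : 𝔸ˣ) : 𝔸) - 1‖ ≤ α₁) →
        (∀ m, 1 ≤ m → m ≤ i.k → ∀ (u : Site d → 𝔸ˣ) (W : Site d → Fin d → 𝔸ˣ) (A' : Site d → Fin d → 𝔸),
          (∀ x, u x ∈ unitaryUnits 𝔸) → (∀ x, x ∉ i.Ω 0 → u x = 1) → mgauge U₀ u W = U' → Restr129 L m (i.Λs m) U₀ u →
          IsLandau138W L m i.η (i.Ω 0) (i.Λs m) U₀ W → (∀ y τ, IsSelfAdjoint (A' y τ)) →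
          (∀ j, j ≤ m → ∀ y τ, SideTouches (i.Ω j) y τ →
          W y τ = cfgExp i.η A' y τ ∧ ‖A' y τ‖ ≤ (2 * (L * (5 * (d : ℝ) * L * inp.B₀ * (α₀ + α₁))) + 8 * (8 * inp.B₀' * (5 * (d : ℝ) * L * inp.B₀) * (α₀ + α₁))) * ((L : ℝ) ^ j * i.η)⁻¹) →
          (∀ y τ, (∀ j, j ≤ m → ¬ SideTouches (i.Ω j) y τ) → A' y τ = 0) →
          msup L m i.η (-(1 : ℝ)) (fun j (b : Site d × Fin d) => SideTouches (i.Ω j) b.1 b.2) (fun b => A' b.1 b.2)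
          ≤ inp.B₀ * (bondNorm L m i.η (-(3 : ℝ)) i.Ω (fun x μ => Jcur i.η U₀ A' μ x)
          + wsup 1 (fun p : {p : ℕ × (Site d × Fin d) // p.1 ≤ m ∧ (p.2 ∈ towerBondsP L i.Ω (i.Λs m) p.1 ∨ (p.1 = 0 ∧ CrossB (i.Ω 0) p.2))} =>
          linCovIter L U₀ (iEta i.η A') p.1.1 p.1.2.1 p.1.2.2))
          + Bbd * msup L m i.η (-(1 : ℝ)) (fun j (b : Site d × Fin d) => j = 0 ∧ SideTouches (i.Ω 0) b.1 b.2 ∧ ¬ BondTouches (i.Ω 0) b.1 b.2)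
              (fun b => A' b.1 b.2) ∧
          msup L m i.η (-(2 : ℝ)) (fun j (t : Fin d × Fin d × Site d) => SideTouches (i.Ω j) t.2.2 t.2.1)
          (fun t => covDerivFwd i.η U₀ t.1 (fun z => A' z t.2.1) t.2.2)
          ≤ inp.B₀ * (bondNorm L m i.η (-(3 : ℝ)) i.Ω (fun x μ => Jcur i.η U₀ A' μ x)
          + wsup 1 (fun p : {p : ℕ × (Site d × Fin d) // p.1 ≤ m ∧ (p.2 ∈ towerBondsP L i.Ω (i.Λs m) p.1 ∨ (p.1 = 0 ∧ CrossB (i.Ω 0) p.2))} =>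
          linCovIter L U₀ (iEta i.η A') p.1.1 p.1.2.1 p.1.2.2))
          + Bbd * msup L m i.η (-(1 : ℝ)) (fun j (b : Site d × Fin d) => j = 0 ∧ SideTouches (i.Ω 0) b.1 b.2 ∧ ¬ BondTouches (i.Ω 0) b.1 b.2)
              (fun b => A' b.1 b.2)))
    (SP5u : ∀ i : ZdIdx d L, SockP5u (𝔸 := 𝔸) L cP cu i.η i.k i.Ω i.Λs)
    -- PROPOSITION 3 AS PRINTED on the re-typed carrier (dag-n05-d's D3), any (1.61)-constant `C₂ ≤ 2097152(d+1)²L²`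
    (hP3 : B8.Prop3Printed d (L : ℝ) C₂ inp B₀β (fun i : ZdIdx d L => (zdGF3P 𝔸 L β len i).toGFData2)) :
    B8.Thm2Printed (fun i : {i : ZdIdx d L // i.Ω 0 = Set.univ} => (zdGF3P 𝔸 L β len i.1).toGFData) := by
  have hL1 : 1 ≤ L := le_trans (by norm_num) hL
  have hd1 : 1 ≤ d := le_trans (by norm_num) hd2
  have hL' : (1 : ℝ) ≤ L := by exact_mod_cast hL1
  have hd' : (1 : ℝ) ≤ d := by exact_mod_cast hd1
  have hB₀ : 0 < inp.B₀ := inp.B₀_pos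
  have hB₀' : 0 < inp.B₀' := inp.B₀'_pos
  -- the bridge constant `K = 26384(d+1)L ≥ 1` and the inflated `K·B₀`
  have hd0 : (0 : ℝ) ≤ d := Nat.cast_nonneg d
  have hK1 : (1 : ℝ) ≤ (26384 * ((d : ℝ) + 1) * L) := by
    have h1 : (26384 : ℝ) * ((d : ℝ) + 1) * 1 ≤ 26384 * ((d : ℝ) + 1) * L := mul_le_mul_of_nonneg_left hL' (by positivity)
    nlinarith [h1, hd0]
  have hK0 : (0 : ℝ) < (26384 * ((d : ℝ) + 1) * L) := by positivity
  have hKB₀ : 0 < (26384 * ((d : ℝ) + 1) * L) * inp.B₀ := mul_pos hK0 hB₀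
  have hBK : 2 ≤ 5 * (d : ℝ) * L * ((26384 * ((d : ℝ) + 1) * L) * inp.B₀) := by
    have h1 : 5 * (d : ℝ) * L * inp.B₀ ≤ 5 * (d : ℝ) * L * ((26384 * ((d : ℝ) + 1) * L) * inp.B₀) := by
      have := le_mul_of_one_le_left hB₀.le hK1
      have h5 : (0 : ℝ) ≤ 5 * (d : ℝ) * L := by positivity
      nlinarith [this, h5]
    exact hB.trans h1
  -- the two instances, the windows
  obtain ⟨c4, hc4, H4⟩ := B8Thm4Zd3Gamma.thm4Body_member_zd3P_γ (𝔸 := 𝔸) hd2 hL β len hB₀ hB₀' hB hcu hcP hBbd hBd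
  obtain ⟨c3, hc3, H3⟩ := hP3
  obtain ⟨cw, hcw, hw⟩ := thm4_windows_γ hd1 hL1 hKB₀ hB₀' hBK
  obtain ⟨cw', hcw', hw'⟩ := thm4_windows_extra (d := d) hL1
  -- constants
  set D : ℝ := 1 + 11 * (d : ℝ) ^ 2 with hD_def
  have hD1 : 1 ≤ D := le_add_of_nonneg_right (by positivity)
  have hD0 : 0 < D := lt_of_lt_of_le one_pos hD1
  have hDne : D ≠ 0 := hD0.ne'
  have hK₁ : 0 < 5 * (d : ℝ) * L * inp.B₀ := by positivity
  have hK₂ : 0 < 5 * (d : ℝ) * L * B₀β := by positivity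
  set B₁ : ℝ := 5 * (d : ℝ) * L * inp.B₀ * D with hB₁_def
  set B₂ : ℝ := 5 * (d : ℝ) * L * B₀β * D with hB₂_def
  have hB₁0 : 0 < B₁ := mul_pos hK₁ hD0
  have hB₂0 : 0 < B₂ := mul_pos hK₂ hD0
  have hK₁D : 0 < 5 * (d : ℝ) * L * ((26384 * ((d : ℝ) + 1) * L) * inp.B₀) * D := mul_pos (by positivity) hD0
  have hK₁Dne : 5 * (d : ℝ) * L * ((26384 * ((d : ℝ) + 1) * L) * inp.B₀) * D ≠ 0 := hK₁D.ne'
  -- the threshold: the shifted pair must fit every window; Prop 3's three smallness conditions; the (1.65) window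
  set cT : ℝ := min (min (c4 / D) (min (cw / D) (cw' / D)))
    (min (min (c3 / D) (c3 / (5 * (d : ℝ) * L * ((26384 * ((d : ℝ) + 1) * L) * inp.B₀) * D))) (1 / (6 * D))) with hcT_def
  have hcT : 0 < cT :=
    lt_min (lt_min (div_pos hc4 hD0) (lt_min (div_pos hcw hD0) (div_pos hcw' hD0)))
      (lt_min (lt_min (div_pos hc3 hD0) (div_pos hc3 hK₁D)) (by positivity))
  refine ⟨B₁, B₂, cT, hB₁0, hB₂0, hcT, ?_⟩
  intro i α₀ α₁ hα₀ hα₁ hs U₀ P hInA hReg hInAAx havg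
  have hS0 : 0 < α₀ + α₁ := add_pos hα₀ hα₁
  -- unpack the thresholds
  have hle : ∀ {c : ℝ}, cT ≤ c / D → D * (α₀ + α₁) ≤ c := by
    intro c hc
    have h1 : α₀ + α₁ ≤ c / D := hs.trans hc
    calc D * (α₀ + α₁) ≤ D * (c / D) := mul_le_mul_of_nonneg_left h1 hD0.le
      _ = c := by field_simp
  have hs4 : D * (α₀ + α₁) ≤ c4 := hle ((min_le_left _ _).trans (min_le_left _ _))
  have hsw : D * (α₀ + α₁) ≤ cw := hle ((min_le_left _ _).trans ((min_le_right _ _).trans (min_le_left _ _)))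
  have hsw' : D * (α₀ + α₁) ≤ cw' := hle ((min_le_left _ _).trans ((min_le_right _ _).trans (min_le_right _ _)))
  have hs3 : D * (α₀ + α₁) ≤ c3 := hle ((min_le_right _ _).trans ((min_le_left _ _).trans (min_le_left _ _)))
  have hs3' : 5 * (d : ℝ) * L * ((26384 * ((d : ℝ) + 1) * L) * inp.B₀) * D * (α₀ + α₁) ≤ c3 := by
    have h1 : α₀ + α₁ ≤ c3 / (5 * (d : ℝ) * L * ((26384 * ((d : ℝ) + 1) * L) * inp.B₀) * D) :=
      hs.trans ((min_le_right _ _).trans ((min_le_left _ _).trans (min_le_right _ _)))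
    calc 5 * (d : ℝ) * L * ((26384 * ((d : ℝ) + 1) * L) * inp.B₀) * D * (α₀ + α₁) ≤ 5 * (d : ℝ) * L * ((26384 * ((d : ℝ) + 1) * L) * inp.B₀) * D * (c3 / (5 * (d : ℝ) * L * ((26384 * ((d : ℝ) + 1) * L) * inp.B₀) * D)) :=
        mul_le_mul_of_nonneg_left h1 hK₁D.le
      _ = c3 := by field_simp
  have hs6 : D * (α₀ + α₁) ≤ 1 / 6 := by
    have h1 : α₀ + α₁ ≤ 1 / (6 * D) := hs.trans ((min_le_right _ _).trans (min_le_right _ _))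
    calc D * (α₀ + α₁) ≤ D * (1 / (6 * D)) := mul_le_mul_of_nonneg_left h1 hD0.le
      _ = 1 / 6 := by field_simp
  -- the shifted pair `(α₀, α″)`
  set α'' : ℝ := 11 * (d : ℝ) ^ 2 * (α₀ + α₁) + α₁ with hα''_def
  have h11 : 0 ≤ 11 * (d : ℝ) ^ 2 * (α₀ + α₁) := by positivity
  have h11' : 0 ≤ 11 * (d : ℝ) ^ 2 * α₁ := by positivity
  have hα'' : 0 < α'' := by rw [hα''_def]; linarith only [h11, hα₁]
  have hsum : α₀ + α'' = D * (α₀ + α₁) := by simp only [hα''_def, hD_def]; ring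
  have hα₁'' : α₁ ≤ α'' := by rw [hα''_def]; linarith only [h11]
  have h165 : 11 * (d : ℝ) ^ 2 * α₀ + α₁ ≤ α'' := by rw [hα''_def]; linarith only [h11']
  -- windows at the shifted pair
  obtain ⟨g5, g6, g7, g9, g10, -, g14⟩ :=
    hw α₀ α'' hα₀ hα'' (hsum ▸ hsw) (5 * (d : ℝ) * L * ((26384 * ((d : ℝ) + 1) * L) * inp.B₀) * (α₀ + α'')) (8 * inp.B₀' * (5 * (d : ℝ) * L * ((26384 * ((d : ℝ) + 1) * L) * inp.B₀)) * (α₀ + α'')) rfl rfl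
  obtain ⟨w19, -⟩ := hw' α₀ α'' hα₀ hα'' (hsum ▸ hsw')
  have hsmall₁ : (d : ℝ) * L * α₁ ≤ 1 / 8 := (mul_le_mul_of_nonneg_left hα₁'' (by positivity)).trans w19
  -- the un-scaled windows `C₀α₀ ≤ 1/3`, `2α₀ ≤ c₂′` for (1.65) (from the γ ones, `α₀ ≤ L²α₀`)
  have hL2 : (1 : ℝ) ≤ (L : ℝ) ^ 2 := one_le_pow₀ hL'
  have hαL2 : α₀ ≤ (L : ℝ) ^ 2 * α₀ := le_mul_of_one_le_left hα₀.le hL2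
  have w5 : C0 d * α₀ ≤ 1 / 3 := (mul_le_mul_of_nonneg_left hαL2 (C0_pos d).le).trans g5
  have hα2 : 2 * α₀ ≤ c2' d L := by linarith only [g6, hα₀, hαL2]
  -- the data
  obtain ⟨hP1, h34, hAx⟩ := hInAAx
  subst hP1
  -- the box-form letter from the member's one-end-point letter (both end-blocks inside ⇒ the first is)
  have havgBox : ∀ j, j ≤ i.1.k → ∀ (z : Site d) (μ : Fin d), (∀ x, InBox (loK L j z) (bondHiK L j z μ) x → x ∈ i.1.Ω j) →
      ‖(avgIter L (mulCfg P.2.1 P.1.1) j z μ : 𝔸) - (avgIter L P.1.1 j z μ : 𝔸)‖ ≤ α₁ :=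
    fun j hj z μ hg => havg j hj z μ (Or.inl fun x hx => hg x (B8Ineq165AllLevels.inBox_bondBox_of_inBox_block_fst L j z μ hx))
  -- (1.66)₀ on all bonds (Ω₀ = ℤᵈ): (1.65)
  have hpart' : ∀ x : Site d, ∃ j, j ≤ i.1.k ∧ ∃ y ∈ i.1.Λs i.1.k j, InBox (tlo L y j) (thi L y j) x := by
    intro x
    have hx : x ∈ i.1.Ω 0 := by rw [i.2]; trivial
    exact i.1.hpart x hx
  have hsm : 11 * (d : ℝ) ^ 2 * α₀ + α₁ ≤ 1 / 6 := by linarith only [h165, hα₀, hsum, hs6]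
  have h66 : ∀ b ∈ {b : Site d × Fin d | SideTouches (i.1.Ω 0) b.1 b.2}, ‖((P.2.1 b.1 b.2 : 𝔸ˣ) : 𝔸) - 1‖ ≤ α'' := by
    intro b _
    have h := norm_pert_sub_one_le_univ hd1 hL i.1.k (η := i.1.η) P.1.2 P.2.2 hα₀ w5 hα2 hα₁.le hsm
      i.1.Ω i.1.hΩ (i.1.Λs i.1.k) i.1.htower hpart' hInA h34 (hAx i.1.k le_rfl) havgBox b.1 b.2
    exact h.trans h165
  have h166 : (zdGF3P 𝔸 L β len i.1).avgClose166 α'' P.1 P :=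
    ⟨fun j hj z μ hb => (havg j hj z μ hb).trans hα₁'', h66⟩
  -- THEOREM 4 at the shifted pair
  have hlayU : ∀ m, 1 ≤ m → m ≤ i.1.k → ∀ y z : Site d, y ∈ i.1.Ω 0 → z ∉ i.1.Ω 0 →
      (∀ l, y l - 1 ≤ z l ∧ z l ≤ y l + 1) → y ∈ i.1.Λs m 0 := by
    intro m _ _ y z _ hz _
    exact absurd (by rw [i.2]; trivial) hz
  obtain ⟨u, hR, ⟨h137'', hLan, h162⟩, huniq⟩ :=
    H4 i.1 hlayU (SP5base i.1) (SP5 i.1) (SH59Dβ i.1) (SP5u i.1) () α₀ α'' hα₀ hα'' (hsum ▸ hs4) P.1 P hInA hReg ⟨rfl, h34, hAx⟩ h166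
  -- (1.37) at the ORIGINAL α₁: the (1.42) lemma on the canonical exponent of the gauge-fixed field
  have hcs0 : 0 ≤ 5 * (d : ℝ) * L * ((26384 * ((d : ℝ) + 1) * L) * inp.B₀) * (α₀ + α'') := by positivity
  have hKS0 : 0 ≤ 2 * (L * (5 * (d : ℝ) * L * ((26384 * ((d : ℝ) + 1) * L) * inp.B₀) * (α₀ + α''))) + 8 * (8 * inp.B₀' * (5 * (d : ℝ) * L * ((26384 * ((d : ℝ) + 1) * L) * inp.B₀)) * (α₀ + α'')) := by
    positivity
  have hcK : 5 * (d : ℝ) * L * ((26384 * ((d : ℝ) + 1) * L) * inp.B₀) * (α₀ + α'') ≤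
      2 * (L * (5 * (d : ℝ) * L * ((26384 * ((d : ℝ) + 1) * L) * inp.B₀) * (α₀ + α''))) + 8 * (8 * inp.B₀' * (5 * (d : ℝ) * L * ((26384 * ((d : ℝ) + 1) * L) * inp.B₀)) * (α₀ + α'')) := by
    have h₁ : (1 : ℝ) * (5 * (d : ℝ) * L * ((26384 * ((d : ℝ) + 1) * L) * inp.B₀) * (α₀ + α'')) ≤ L * (5 * (d : ℝ) * L * ((26384 * ((d : ℝ) + 1) * L) * inp.B₀) * (α₀ + α'')) :=
      mul_le_mul_of_nonneg_right hL' hcs0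
    have h₂ : 0 ≤ 8 * (8 * inp.B₀' * (5 * (d : ℝ) * L * ((26384 * ((d : ℝ) + 1) * L) * inp.B₀)) * (α₀ + α'')) := by positivity
    linarith only [h₁, h₂, hcs0]
  have h16KS : 16 * (2 * (L * (5 * (d : ℝ) * L * ((26384 * ((d : ℝ) + 1) * L) * inp.B₀) * (α₀ + α''))) + 8 * (8 * inp.B₀' * (5 * (d : ℝ) * L * ((26384 * ((d : ℝ) + 1) * L) * inp.B₀)) * (α₀ + α''))) ≤ 1 := by
    have h₁ := mul_le_mul_of_nonneg_right hL' hKS0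
    linarith only [g7, h₁]
  have hc16 : 16 * (5 * (d : ℝ) * L * ((26384 * ((d : ℝ) + 1) * L) * inp.B₀) * (α₀ + α'')) ≤ 1 := by linarith only [h16KS, hcK, hKS0]
  have hu : ∀ x, u.1 x ∈ unitaryUnits 𝔸 := u.2.1
  have hW : mgauge P.1.1 u.1 (mgauge P.1.1 u.1⁻¹ P.2.1) = P.2.1 := mgauge_mgauge_inv P.1.1 P.2.1 u.1
  have hWu : ∀ x κ, mgauge P.1.1 u.1⁻¹ P.2.1 x κ ∈ unitaryUnits 𝔸 := mem_unitaryUnits_of_mgauge_eq P.1.2 P.2.2 hu hW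
  have hWA : ∀ j, j ≤ i.1.k → ∀ y τ, SideTouches (i.1.Ω j) y τ →
      mgauge P.1.1 u.1⁻¹ P.2.1 y τ = cfgExp i.1.η (logCfg i.1.η (mgauge P.1.1 u.1⁻¹ P.2.1)) y τ ∧
        ‖logCfg i.1.η (mgauge P.1.1 u.1⁻¹ P.2.1) y τ‖ ≤ (5 * (d : ℝ) * L * ((26384 * ((d : ℝ) + 1) * L) * inp.B₀) * (α₀ + α'')) * ((L : ℝ) ^ j * i.1.η)⁻¹ :=
    fun j hj y τ h => ⟨(h162 j hj (y, τ) h).1, (h162 j hj (y, τ) h).2.2⟩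
  obtain ⟨hA'sa, hA'eq, hA'zero⟩ := mlogCfg_spec i.1.hη hL1 i.1.k P.1.1 hWu hcs0 hc16 i.1.Ω hWA
  set A' := mlogCfg i.1.k i.1.η i.1.Ω (mgauge P.1.1 u.1⁻¹ P.2.1) with hA'_def
  have hA'bd : ∀ j, j ≤ i.1.k → ∀ y τ, SideTouches (i.1.Ω j) y τ →
      mgauge P.1.1 u.1⁻¹ P.2.1 y τ = cfgExp i.1.η A' y τ ∧
        ‖A' y τ‖ ≤ (2 * (L * (5 * (d : ℝ) * L * ((26384 * ((d : ℝ) + 1) * L) * inp.B₀) * (α₀ + α''))) + 8 * (8 * inp.B₀' * (5 * (d : ℝ) * L * ((26384 * ((d : ℝ) + 1) * L) * inp.B₀)) * (α₀ + α''))) *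
          ((L : ℝ) ^ j * i.1.η)⁻¹ := by
    intro j hj y τ h
    obtain ⟨hAA, hWexp⟩ := hA'eq j hj y τ h
    refine ⟨hWexp, ?_⟩
    rw [hAA]
    have hη0 : 0 ≤ i.1.η := i.1.hη.le
    exact ((hWA j hj y τ h).2).trans (mul_le_mul_of_nonneg_right hcK (by positivity))
  obtain ⟨hboxP, hclassP⟩ := B8TowerBondsPrinted.ZdIdx.towerBondsP_laws i.1
  have h137 : (zdGF3P 𝔸 L β len i.1).C137 α₁ P.1 ((zdGF3P 𝔸 L β len i.1).act P u) :=
    B8Eq142KLevelLocalGammaPrime.H42_of_inAx_γ' hd2 i.1.hη hL i.1.k P.1.2 hα₀ hα₁ hKS0 g5 g6 g7 g9 g10 hsmall₁ i.1.Ω i.1.hΩ i.1.Λs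
      (fun m j => towerBondsP L i.1.Ω (i.1.Λs m) j) hboxP hclassP hInA h34 hAx (fun j hj z μ hg => havg j hj z μ hg)
      (fun m W => IsLandau138W L m i.1.η (i.1.Ω 0) (i.1.Λs m) P.1.1 W) i.1.k i.1.hk le_rfl i.1.htower u.1
      (mgauge P.1.1 u.1⁻¹ P.2.1) A' hu hW hR hLan hA'sa hA'bd hA'zero
  -- PROPOSITION 3 at (α₀, α″, α₂ := c⋆″) for the gauge-fixed field
  have hSD : α₀ + α₁ ≤ D * (α₀ + α₁) := le_mul_of_one_le_left hS0.le hD1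
  have hα₀3 : α₀ ≤ c3 := by linarith only [hα₁, hSD, hs3]
  have hα''3 : α'' ≤ c3 := by linarith only [hα₀, hsum, hs3]
  have hcs3 : 5 * (d : ℝ) * L * ((26384 * ((d : ℝ) + 1) * L) * inp.B₀) * (α₀ + α'') ≤ c3 := by
    rw [hsum, ← mul_assoc]; exact hs3'
  have hcspos : 0 < 5 * (d : ℝ) * L * ((26384 * ((d : ℝ) + 1) * L) * inp.B₀) * (α₀ + α'') := by positivity
  have h61 : 2 * (5 * (d : ℝ) * L * ((26384 * ((d : ℝ) + 1) * L) * inp.B₀) * (α₀ + α'')) ^ 2 + 20 * d * α₀ * (5 * (d : ℝ) * L * ((26384 * ((d : ℝ) + 1) * L) * inp.B₀) * (α₀ + α'')) +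
      2 * C₂ * (5 * (d : ℝ) * L * ((26384 * ((d : ℝ) + 1) * L) * inp.B₀) * (α₀ + α'')) ^ 2 ≤ α₀ + α'' := by
    set c := 5 * (d : ℝ) * L * ((26384 * ((d : ℝ) + 1) * L) * inp.B₀) * (α₀ + α'') with hc
    set K := 2 * (L * c) + 8 * (8 * inp.B₀' * (5 * (d : ℝ) * L * ((26384 * ((d : ℝ) + 1) * L) * inp.B₀)) * (α₀ + α'')) with hK
    have hcKle : c ≤ K := hcK
    have hc0 : 0 ≤ c := hcs0
    have hC : (16 : ℝ) * (131072 * ((d : ℝ) + 1) ^ 2) * (L : ℝ) ^ 2 = 2097152 * ((d : ℝ) + 1) ^ 2 * (L : ℝ) ^ 2 := by ring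
    have hC₂' : C₂ ≤ 16 * (131072 * ((d : ℝ) + 1) ^ 2) * (L : ℝ) ^ 2 := by rw [hC]; exact hC₂
    have hmono : 2 * c ^ 2 + 20 * d * α₀ * c + 2 * C₂ * c ^ 2 ≤
        2 * K ^ 2 + 20 * d * α₀ * K + 2 * (16 * (131072 * ((d : ℝ) + 1) ^ 2) * (L : ℝ) ^ 2) * K ^ 2 := by
      have h1 : c ^ 2 ≤ K ^ 2 := pow_le_pow_left₀ hc0 hcKle 2
      have h2 : 0 ≤ 20 * (d : ℝ) * α₀ := by positivity
      have h3 : 0 ≤ 2 * (16 * (131072 * ((d : ℝ) + 1) ^ 2) * (L : ℝ) ^ 2) := by positivity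
      have h4 := mul_le_mul_of_nonneg_left hcKle h2
      have h5 := mul_le_mul_of_nonneg_left h1 h3
      have h6 : 2 * C₂ * c ^ 2 ≤ 2 * (16 * (131072 * ((d : ℝ) + 1) ^ 2) * (L : ℝ) ^ 2) * c ^ 2 :=
        mul_le_mul_of_nonneg_right (by linarith only [hC₂']) (sq_nonneg _)
      linarith only [h1, h4, h5, h6]
    exact hmono.trans g14
  have hPair : (zdGF3P 𝔸 L β len i.1).InAPair α₀ P.1 ((zdGF3P 𝔸 L β len i.1).act P u) := by
    show InAk L i.1.k i.1.η α₀ i.1.Ω (mulCfg (mgauge P.1.1 u.1⁻¹ P.2.1) P.1.1)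
    have hui : ∀ x, u.1⁻¹ x ∈ U1 𝔸 := fun x => unitaryUnits_le_U1 ((unitaryUnits 𝔸).inv_mem (hu x))
    rw [mulCfg_eq_gaugeAct_of_mgauge_eq hW]
    exact (B8Ineq132.inAk_gaugeAct_iff L i.1.k i.1.η α₀ i.1.Ω hui _).2 h34
  have h162' : (zdGF3P 𝔸 L β len i.1).C162 1 (5 * (d : ℝ) * L * ((26384 * ((d : ℝ) + 1) * L) * inp.B₀) * (α₀ + α'')) P.1 ((zdGF3P 𝔸 L β len i.1).act P u) := by
    intro j hj b hb
    obtain ⟨h1, h2, h3⟩ := h162 j hj b hb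
    exact ⟨h1, h2, by rw [one_mul]; exact h3⟩
  obtain ⟨h136, h139⟩ := H3 i.1 α₀ α'' (5 * (d : ℝ) * L * ((26384 * ((d : ℝ) + 1) * L) * inp.B₀) * (α₀ + α'')) hα₀ hα₀3 hα'' hα''3 hcspos hcs3 h61 P.1
    ((zdGF3P 𝔸 L β len i.1).act P u) hInA hReg hPair h162' hLan h137''
  -- constants: `5dLB₀(α₀ + α″) = B₁(α₀ + α₁)`, `5dL·B₀β·(α₀ + α″) = B₂(α₀ + α₁)`
  have e1 : 5 * (d : ℝ) * (L : ℝ) * inp.B₀ * (α₀ + α'') = B₁ * (α₀ + α₁) := by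
    rw [hsum, hB₁_def]; ring
  have e2 : 5 * (d : ℝ) * (L : ℝ) * B₀β * (α₀ + α'') = B₂ * (α₀ + α₁) := by rw [hsum, hB₂_def]; ring
  obtain ⟨h136a, h136g, h136h⟩ := h136
  obtain ⟨h139j, h139l⟩ := h139
  refine ⟨u, hR, ⟨⟨fun j hj b hb => ?_, by rw [← e1]; exact h136g, by rw [← e2]; exact h136h⟩, h137, hLan,
    ⟨by rw [← e1]; exact h139j, by rw [← e1]; exact h139l⟩⟩, ?_⟩
  · obtain ⟨h1, h2, h3⟩ := h136a j hj b hb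
    exact ⟨h1, h2, by rw [← e1]; exact h3⟩
  -- uniqueness: Theorem 4's, since (1.36) at `B₁(α₀ + α₁) = B₁′(α₀ + α″)` is (1.62) there and (1.37) is monotone in α₁
  · intro u' hR' h136' h137' hLan' _
    refine huniq u' hR' ?_ hLan' ?_
    · intro j hj c hc
      have hmono : 2 * (d : ℝ) * L * α₁ ≤ 2 * d * L * α'' := mul_le_mul_of_nonneg_left hα₁'' (by positivity)
      exact (h137' j hj c hc).trans_le hmono
    · intro j hj b hb
      obtain ⟨h1, h2, h3⟩ := h136'.1 j hj b hb
      refine ⟨h1, h2, ?_⟩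
      have e1' : B₁ * (α₀ + α₁) = 5 * (d : ℝ) * L * inp.B₀ * (α₀ + α'') := by rw [hsum, hB₁_def]; ring
      have hle : 5 * (d : ℝ) * L * inp.B₀ * (α₀ + α'') ≤ 5 * (d : ℝ) * L * ((26384 * ((d : ℝ) + 1) * L) * inp.B₀) * (α₀ + α'') := by
        have h₁ : inp.B₀ ≤ (26384 * ((d : ℝ) + 1) * L) * inp.B₀ := le_mul_of_one_le_left hB₀.le hK1
        have h₂ : 0 ≤ 5 * (d : ℝ) * L := by positivity
        have h₃ : 0 ≤ α₀ + α'' := by positivity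
        exact mul_le_mul_of_nonneg_right (mul_le_mul_of_nonneg_left h₁ h₂) h₃
      have hw0 : 0 ≤ ((L : ℝ) ^ j * i.1.η)⁻¹ := inv_nonneg.2 (mul_nonneg (pow_nonneg (Nat.cast_nonneg _) _) i.1.hη.le)
      exact h3.trans (mul_le_mul_of_nonneg_right (e1'.le.trans hle) hw0)

/-- ★★ **The same on the record's H-twin `zdGF3HP`** (Theorem 8's source space as printed; `(zdGF3HP …).toGFData = (zdGF3P …).toGFData` by `rfl`,
`B8LeafModelZd3P.zdGF3HP_toGFData`) — the form NODE 00's re-pinned slot reads. [cite: Balaban1985RegularSpaces, Thm 2 p.83, Thm 8 (1.146) p.101 (bookkeeping)] -/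
theorem thm2Printed_zd3HP_univ_γ (hd2 : 2 ≤ d) {L : ℕ} (hL : 2 ≤ L) {β : ℝ} {len : Site d → ℝ} (inp : B8.B9Inputs)
    {B₀β cu cP Bbd C₂ : ℝ} (hB₀β : 0 < B₀β) (hB : 2 ≤ 5 * (d : ℝ) * L * inp.B₀) (hcu : 0 < cu) (hcP : 0 < cP)
    (hBbd : 0 ≤ Bbd) (hBd : 4 * Bbd ≤ ((d : ℝ) * L - 1) * inp.B₀) (hC₂ : C₂ ≤ 2097152 * ((d : ℝ) + 1) ^ 2 * (L : ℝ) ^ 2)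
    -- Theorem 4's four sockets per member (this seat's `B8Thm4Zd3Gamma.thm4Body_member_zd3P_γ`), the (1.59) one over print's class `towerBondsP`
    (SP5base : ∀ i : ZdIdx d L, SockP5base (𝔸 := 𝔸) L inp.B₀ inp.B₀' cP i.η i.k i.Ω i.Λs)
    (SP5 : ∀ i : ZdIdx d L, SockP5 (𝔸 := 𝔸) L inp.B₀ inp.B₀' cP i.η i.k i.Ω i.Λs)
    (SH59Dβ : ∀ i : ZdIdx d L, ∀ α₀ α₁ : ℝ, 0 < α₀ → 0 < α₁ → α₀ + α₁ ≤ cP →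
        ∀ U₀ U' : Site d → Fin d → 𝔸ˣ, (∀ x κ, U₀ x κ ∈ unitaryUnits 𝔸) → (∀ x κ, U' x κ ∈ unitaryUnits 𝔸) →
        InAk L i.k i.η α₀ i.Ω U₀ → InAk L i.k i.η α₀ i.Ω (mulCfg U' U₀) → (∀ m, m ≤ i.k → InAx L m (i.Λs m) U₀ (mulCfg U' U₀)) →
        (∀ j, j ≤ i.k → ∀ (z : Site d) (μ : Fin d), (∀ x, InBox (loK L j z) (bondHiK L j z μ) x → x ∈ i.Ω j) →
          ‖(avgIter L (mulCfg U' U₀) j z μ : 𝔸) - (avgIter L U₀ j z μ : 𝔸)‖ ≤ α₁) →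
        (∀ b ∈ {b : Site d × Fin d | SideTouches (i.Ω 0) b.1 b.2}, ‖((U' b.1 b.2 : 𝔸ˣ) : 𝔸) - 1‖ ≤ α₁) →
        (∀ m, 1 ≤ m → m ≤ i.k → ∀ (u : Site d → 𝔸ˣ) (W : Site d → Fin d → 𝔸ˣ) (A' : Site d → Fin d → 𝔸),
          (∀ x, u x ∈ unitaryUnits 𝔸) → (∀ x, x ∉ i.Ω 0 → u x = 1) → mgauge U₀ u W = U' → Restr129 L m (i.Λs m) U₀ u →
          IsLandau138W L m i.η (i.Ω 0) (i.Λs m) U₀ W → (∀ y τ, IsSelfAdjoint (A' y τ)) →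
          (∀ j, j ≤ m → ∀ y τ, SideTouches (i.Ω j) y τ →
          W y τ = cfgExp i.η A' y τ ∧ ‖A' y τ‖ ≤ (2 * (L * (5 * (d : ℝ) * L * inp.B₀ * (α₀ + α₁))) + 8 * (8 * inp.B₀' * (5 * (d : ℝ) * L * inp.B₀) * (α₀ + α₁))) * ((L : ℝ) ^ j * i.η)⁻¹) →
          (∀ y τ, (∀ j, j ≤ m → ¬ SideTouches (i.Ω j) y τ) → A' y τ = 0) →
          msup L m i.η (-(1 : ℝ)) (fun j (b : Site d × Fin d) => SideTouches (i.Ω j) b.1 b.2) (fun b => A' b.1 b.2)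
          ≤ inp.B₀ * (bondNorm L m i.η (-(3 : ℝ)) i.Ω (fun x μ => Jcur i.η U₀ A' μ x)
          + wsup 1 (fun p : {p : ℕ × (Site d × Fin d) // p.1 ≤ m ∧ (p.2 ∈ towerBondsP L i.Ω (i.Λs m) p.1 ∨ (p.1 = 0 ∧ CrossB (i.Ω 0) p.2))} =>
          linCovIter L U₀ (iEta i.η A') p.1.1 p.1.2.1 p.1.2.2))
          + Bbd * msup L m i.η (-(1 : ℝ)) (fun j (b : Site d × Fin d) => j = 0 ∧ SideTouches (i.Ω 0) b.1 b.2 ∧ ¬ BondTouches (i.Ω 0) b.1 b.2)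
              (fun b => A' b.1 b.2) ∧
          msup L m i.η (-(2 : ℝ)) (fun j (t : Fin d × Fin d × Site d) => SideTouches (i.Ω j) t.2.2 t.2.1)
          (fun t => covDerivFwd i.η U₀ t.1 (fun z => A' z t.2.1) t.2.2)
          ≤ inp.B₀ * (bondNorm L m i.η (-(3 : ℝ)) i.Ω (fun x μ => Jcur i.η U₀ A' μ x)
          + wsup 1 (fun p : {p : ℕ × (Site d × Fin d) // p.1 ≤ m ∧ (p.2 ∈ towerBondsP L i.Ω (i.Λs m) p.1 ∨ (p.1 = 0 ∧ CrossB (i.Ω 0) p.2))} =>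
          linCovIter L U₀ (iEta i.η A') p.1.1 p.1.2.1 p.1.2.2))
          + Bbd * msup L m i.η (-(1 : ℝ)) (fun j (b : Site d × Fin d) => j = 0 ∧ SideTouches (i.Ω 0) b.1 b.2 ∧ ¬ BondTouches (i.Ω 0) b.1 b.2)
              (fun b => A' b.1 b.2)))
    (SP5u : ∀ i : ZdIdx d L, SockP5u (𝔸 := 𝔸) L cP cu i.η i.k i.Ω i.Λs)
    -- PROPOSITION 3 AS PRINTED on the re-typed carrier (dag-n05-d's D3), any (1.61)-constant `C₂ ≤ 2097152(d+1)²L²`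
    (hP3 : B8.Prop3Printed d (L : ℝ) C₂ inp B₀β (fun i : ZdIdx d L => (zdGF3P 𝔸 L β len i).toGFData2)) :
    B8.Thm2Printed (fun i : {i : ZdIdx d L // i.Ω 0 = Set.univ} => (zdGF3HP 𝔸 L β len i.1).toGFData) :=
  thm2Printed_zd3P_univ_γ (𝔸 := 𝔸) hd2 hL inp hB₀β hB hcu hcP hBbd hBd hC₂ SP5base SP5 SH59Dβ SP5u hP3

end Thm2

#print axioms thm2Printed_zd3P_univ_γ
#print axioms thm2Printed_zd3HP_univ_γ

end Literature.MathematicalPhysics.QuantumFieldTheory.Balaban1983to89.B8LeafModelZd3PThm2Gamma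

end
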